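import Mathlib.Analysis.Fourier.Inversion
import Mathlib.Analysis.SpecialFunctions.ImproperIntegrals
import Mathlib.Analysis.SpecialFunctions.Trigonometric.Bounds
import Mathlib.Analysis.Real.Pi.Bounds
import Literature.NumberTheory.LFunctions.FejerMeanValue
import HarnessLib

/-!
# The Fejér kernel as the Fourier transform of the triangle (toolkit for Gallagher's lemma), PROVED

Topic `Literature/NumberTheory/LFunctions`.  Everything in this file is PROVED (no named facts).  It is the
Fourier-analytic half of the classical proof of GALLAGHER'S LEMMA (Gallagher 1970, Lemma 1; Montgomery 1971,
LNM 227, Lemma 1.9), completed in `GallagherShortWindowMeanValue.lean`: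

* `Gallagher.tri δ u = (δ − |u|)₊` — the triangle `Δ_δ` (continuous, support `⊆ (−δ, δ]`, integrable);
* `Gallagher.fejerK δ t = 2δ · k_δ(2πt)` with `k` the tree's `fejerWeightCos` — i.e. `K_δ(0) = δ²`,
  `K_δ(t) = sin²(πδt)/(πt)²` (`fejerK_zero`, `fejerK_of_ne_zero`); `0 ≤ K_δ ≤ min(δ², 1/(πt)²)`;
* `Gallagher.fourier_triC` : `𝓕 Δ_δ = K_δ` (split `[−δ, δ]` at `0`, fold `v ↦ −v`, `e(x) + e(−x) = 2 cos`);
* `Gallagher.integrable_fourier_triC` (majorant `2(δ² + π⁻²)/(1 + t²)`) and, by Mathlib's Fourier inversion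
  (`Continuous.fourierInv_fourier_eq`), `Gallagher.integral_fejerK_mul_cexp` : `∫ K_δ(t) e(tu) dt = Δ_δ(u)`;
* `Gallagher.fejerK_ge` : JORDAN's inequality `sin x ≥ (2/π)x` gives `K_δ(t) ≥ 4δ²/π²` for `|t| ≤ T`, `δT ≤ 1/2`.

## References
* [Gallagher1970] P. X. Gallagher, *A large sieve density estimate near σ = 1*, Invent. Math. 11 (1970), Lemma 1.
* [Montgomery1971] H. L. Montgomery, *Topics in multiplicative number theory*, LNM 227 (1971), Lemma 1.9.
-/

noncomputable section

open Real MeasureTheory Complex Finset Set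
open scoped FourierTransform ComplexConjugate

namespace Literature.NumberTheory.LFunctions

namespace Gallagher

/-! ### The triangle kernel and its Fourier transform -/

/-- The triangle `Δ_δ(u) = (δ − |u|)₊`. [cite: Gallagher1970, Lemma 1 (proof step)] -/
def tri (δ u : ℝ) : ℝ := max (δ - |u|) 0

/-- The triangle as a complex-valued function of `u`. [cite: Gallagher1970, Lemma 1 (proof step)] -/
def triC (δ : ℝ) : ℝ → ℂ := fun u => (tri δ u : ℂ)

/-- The Fejér kernel `K_δ(t) = 2δ · k_δ(2πt)` (`k` = the tree's `fejerWeightCos`), i.e.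
`K_δ(t) = sin²(πδt)/(π t)²` for `t ≠ 0` and `K_δ(0) = δ²`. [cite: Gallagher1970, Lemma 1 (proof step)] -/
def fejerK (δ t : ℝ) : ℝ := 2 * δ * fejerWeightCos δ (2 * π * t)

/-- `Δ_δ ≥ 0`. [cite: Gallagher1970, Lemma 1 (proof step)] -/
theorem tri_nonneg (δ u : ℝ) : 0 ≤ tri δ u := le_max_right _ _

/-- `Δ_δ ≤ max δ 0`. [cite: Gallagher1970, Lemma 1 (proof step)] -/
theorem tri_le (δ u : ℝ) : tri δ u ≤ max δ 0 := by
  unfold tri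
  exact max_le_max (by linarith [abs_nonneg u]) le_rfl

/-- `Δ_δ(u) = δ − |u|` when `|u| ≤ δ`. [cite: Gallagher1970, Lemma 1 (proof step)] -/
theorem tri_of_abs_le {δ u : ℝ} (h : |u| ≤ δ) : tri δ u = δ - |u| := by
  unfold tri; exact max_eq_left (by linarith)

/-- `Δ_δ(u) = 0` when `δ ≤ |u|`. [cite: Gallagher1970, Lemma 1 (proof step)] -/
theorem tri_of_le_abs {δ u : ℝ} (h : δ ≤ |u|) : tri δ u = 0 := by
  unfold tri; exact max_eq_right (by linarith)

/-- `Δ_δ` is even. [cite: Gallagher1970, Lemma 1 (proof step)] -/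
theorem tri_neg (δ u : ℝ) : tri δ (-u) = tri δ u := by simp [tri, abs_neg]

/-- `Δ_δ` is `δ`-Lipschitz-like: continuous. [cite: Gallagher1970, Lemma 1 (proof step)] -/
theorem continuous_tri (δ : ℝ) : Continuous (tri δ) := by
  unfold tri
  exact (continuous_const.sub continuous_abs).max continuous_const

/-- `Δ_δ : ℝ → ℂ` is continuous. [cite: Gallagher1970, Lemma 1 (proof step)] -/
theorem continuous_triC (δ : ℝ) : Continuous (triC δ) :=
  continuous_ofReal.comp (continuous_tri δ)

/-- The support of `Δ_δ` lies in `(−δ, δ]` (`δ > 0`). [cite: Gallagher1970, Lemma 1 (proof step)] -/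
theorem support_triC_subset {δ : ℝ} (hδ : 0 < δ) : Function.support (triC δ) ⊆ Ioc (-δ) δ := by
  intro u hu
  rw [Function.mem_support] at hu
  by_contra h
  apply hu
  simp only [triC, ofReal_eq_zero]
  apply tri_of_le_abs
  simp only [Set.mem_Ioc, not_and_or, not_lt, not_le] at h
  rcases h with h | h
  · rw [abs_of_nonpos (by linarith)]; linarith
  · rw [abs_of_pos (by linarith)]; linarith

/-- `Δ_δ` has compact support (`δ > 0`). [cite: Gallagher1970, Lemma 1 (proof step)] -/
theorem hasCompactSupport_triC {δ : ℝ} (hδ : 0 < δ) : HasCompactSupport (triC δ) :=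
  HasCompactSupport.of_support_subset_isCompact isCompact_Icc
    ((support_triC_subset hδ).trans Ioc_subset_Icc_self)

/-- `Δ_δ` is integrable (`δ > 0`). [cite: Gallagher1970, Lemma 1 (proof step)] -/
theorem integrable_triC {δ : ℝ} (hδ : 0 < δ) : Integrable (triC δ) :=
  (continuous_triC δ).integrable_of_hasCompactSupport (hasCompactSupport_triC hδ)

/-- `K_δ(0) = δ²`. [cite: Gallagher1970, Lemma 1 (proof step)] -/
theorem fejerK_zero (δ : ℝ) : fejerK δ 0 = δ ^ 2 := by
  simp [fejerK, fejerWeightCos_zero]; ring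

/-- `K_δ(t) = (1 − cos 2πδt)/(2π²t²) = sin²(πδt)/(πt)²` for `t ≠ 0`. [cite: Gallagher1970, Lemma 1 (proof step)] -/
theorem fejerK_of_ne_zero {δ t : ℝ} (hδ : δ ≠ 0) (ht : t ≠ 0) :
    fejerK δ t = Real.sin (π * δ * t) ^ 2 / (π * t) ^ 2 := by
  have h2 : 2 * π * t ≠ 0 := by positivity
  rw [fejerK, fejerWeightCos_of_ne_zero hδ h2]
  have hc : Real.cos (δ * (2 * π * t)) = 1 - 2 * Real.sin (π * δ * t) ^ 2 := by
    rw [show δ * (2 * π * t) = 2 * (π * δ * t) by ring, Real.cos_two_mul, Real.sin_sq]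
    ring
  rw [hc]
  field_simp
  ring

/-- `K_δ ≥ 0` (`δ > 0`). [cite: Gallagher1970, Lemma 1 (proof step)] -/
theorem fejerK_nonneg {δ : ℝ} (hδ : 0 < δ) (t : ℝ) : 0 ≤ fejerK δ t := by
  unfold fejerK
  exact mul_nonneg (by positivity) (fejerWeightCos_nonneg hδ _)

/-- `K_δ ≤ δ²` (from `sin² x ≤ x²`). [cite: Gallagher1970, Lemma 1 (proof step)] -/
theorem fejerK_le_sq {δ : ℝ} (hδ : 0 < δ) (t : ℝ) : fejerK δ t ≤ δ ^ 2 := by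
  rcases eq_or_ne t 0 with rfl | ht
  · rw [fejerK_zero]
  rw [fejerK_of_ne_zero hδ.ne' ht, div_le_iff₀ (by positivity)]
  calc Real.sin (π * δ * t) ^ 2 ≤ (π * δ * t) ^ 2 := Real.sin_sq_le_sq
    _ = δ ^ 2 * (π * t) ^ 2 := by ring

/-- `K_δ(t) ≤ 1/(π t)²` for `t ≠ 0`. [cite: Gallagher1970, Lemma 1 (proof step)] -/
theorem fejerK_le_inv_sq {δ t : ℝ} (hδ : 0 < δ) (ht : t ≠ 0) : fejerK δ t ≤ 1 / (π * t) ^ 2 := by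
  rw [fejerK_of_ne_zero hδ.ne' ht]
  gcongr
  · rw [sq_le_one_iff_abs_le_one]; exact Real.abs_sin_le_one _

/-! ### `𝓕 Δ_δ = K_δ`, integrability of `K_δ`, Fourier inversion -/

/-- The integrand of `𝓕 Δ_δ(t)`. [folklore] -/
private def fInt (δ t : ℝ) : ℝ → ℂ := fun v => cexp (↑(-2 * π * v * t) * I) * triC δ v

/-- The integrand of `𝓕 Δ_δ(t)` is continuous in `v`. [folklore] -/
private theorem continuous_fInt (δ t : ℝ) : Continuous (fInt δ t) := by
  unfold fInt
  refine Continuous.mul ?_ (continuous_triC δ)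
  refine Complex.continuous_exp.comp ?_
  exact (continuous_ofReal.comp (by continuity)).mul continuous_const

/-- The integrand of `𝓕 Δ_δ(t)` vanishes off `(−δ, δ]`. [folklore] -/
private theorem support_fInt_subset {δ : ℝ} (hδ : 0 < δ) (t : ℝ) :
    Function.support (fInt δ t) ⊆ Ioc (-δ) δ := by
  intro v hv
  apply support_triC_subset hδ
  rw [Function.mem_support] at hv ⊢
  intro h
  exact hv (by simp [fInt, h])

/-- Folding `v ↦ −v`: on `[0, δ]`, `g(−v) + g(v) = 2δ · (1 − v/δ) cos(v · 2πt)` (as a complex number). [folklore] -/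
private theorem fInt_neg_add {δ t v : ℝ} (hv0 : 0 ≤ v) (hvδ : v ≤ δ) (hδ : 0 < δ) :
    fInt δ t (-v) + fInt δ t v = (((2 * δ) * ((1 - v / δ) * Real.cos (v * (2 * π * t))) : ℝ) : ℂ) := by
  have htri : tri δ v = δ - v := by
    rw [tri_of_abs_le (by rw [abs_of_nonneg hv0]; exact hvδ), abs_of_nonneg hv0]
  have hcos : cexp (↑(2 * π * v * t) * I) + cexp (↑(-2 * π * v * t) * I)
      = ((2 * Real.cos (v * (2 * π * t)) : ℝ) : ℂ) := by
    have : (↑(-2 * π * v * t) : ℂ) = -(↑(2 * π * v * t) : ℂ) := by push_cast; ring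
    rw [this, ← Complex.two_cos, show v * (2 * π * t) = 2 * π * v * t by ring]
    push_cast
    rfl
  simp only [fInt, triC, tri_neg, htri]
  rw [show (↑(-2 * π * -v * t) : ℂ) = ↑(2 * π * v * t) by push_cast; ring]
  rw [← add_mul, hcos]
  have hδ' : (δ : ℂ) ≠ 0 := by exact_mod_cast hδ.ne'
  push_cast
  field_simp

/-- **`𝓕 Δ_δ = K_δ`**: the Fourier transform of the triangle is the Fejér kernel. [cite: Gallagher1970, Lemma 1 (proof step)] -/
theorem fourier_triC {δ : ℝ} (hδ : 0 < δ) (t : ℝ) : 𝓕 (triC δ) t = (fejerK δ t : ℂ) := by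
  rw [Real.fourier_real_eq_integral_exp_smul]
  simp only [smul_eq_mul]
  change ∫ v, fInt δ t v = _
  have hgc := continuous_fInt δ t
  rw [← intervalIntegral.integral_eq_integral_of_support_subset (support_fInt_subset hδ t),
    ← intervalIntegral.integral_add_adjacent_intervals (hgc.intervalIntegrable (-δ) 0)
      (hgc.intervalIntegrable 0 δ)]
  have h1 : ∫ v in (-δ)..0, fInt δ t v = ∫ v in (0:ℝ)..δ, fInt δ t (-v) := by
    rw [intervalIntegral.integral_comp_neg]; simp
  have hi1 : IntervalIntegrable (fun v => fInt δ t (-v)) volume 0 δ :=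
    (hgc.comp continuous_neg).intervalIntegrable 0 δ
  rw [h1, ← intervalIntegral.integral_add hi1 (hgc.intervalIntegrable 0 δ)]
  have h2 : Set.EqOn (fun v => fInt δ t (-v) + fInt δ t v)
      (fun v => (((2 * δ) * ((1 - v / δ) * Real.cos (v * (2 * π * t))) : ℝ) : ℂ)) (uIcc 0 δ) := by
    intro v hv
    rw [uIcc_of_le hδ.le, Set.mem_Icc] at hv
    exact fInt_neg_add hv.1 hv.2 hδ
  rw [intervalIntegral.integral_congr h2, intervalIntegral.integral_ofReal,
    intervalIntegral.integral_const_mul]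
  rfl

/-- `K_δ ≤ 2(δ² + 1/π²)/(1 + t²)` — an integrable majorant. [cite: Gallagher1970, Lemma 1 (proof step)] -/
theorem fejerK_le_majorant {δ : ℝ} (hδ : 0 < δ) (t : ℝ) :
    fejerK δ t ≤ 2 * (δ ^ 2 + 1 / π ^ 2) * (1 + t ^ 2)⁻¹ := by
  have hπ : 0 < π := Real.pi_pos
  rw [← div_eq_mul_inv, le_div_iff₀ (by positivity)]
  by_cases ht : |t| ≤ 1
  · have h1 : t ^ 2 ≤ 1 := by
      have := abs_le.mp ht; nlinarith
    calc fejerK δ t * (1 + t ^ 2) ≤ δ ^ 2 * (1 + 1) :=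
          mul_le_mul (fejerK_le_sq hδ t) (by linarith) (by positivity) (by positivity)
      _ ≤ 2 * (δ ^ 2 + 1 / π ^ 2) := by
          have : 0 ≤ 1 / π ^ 2 := by positivity
          linarith
  · have ht1 : 1 < |t| := lt_of_not_ge ht
    have ht0 : t ≠ 0 := by
      intro h; rw [h, abs_zero] at ht1; linarith
    have h2 : 1 ≤ t ^ 2 := by
      have : 1 < |t| ^ 2 := by nlinarith
      rw [sq_abs] at this; exact this.le
    calc fejerK δ t * (1 + t ^ 2) ≤ 1 / (π * t) ^ 2 * (t ^ 2 + t ^ 2) :=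
          mul_le_mul (fejerK_le_inv_sq hδ ht0) (by linarith) (by positivity) (by positivity)
      _ = 2 * (1 / π ^ 2) := by field_simp; norm_num
      _ ≤ 2 * (δ ^ 2 + 1 / π ^ 2) := by nlinarith [sq_nonneg δ]

/-- `𝓕 Δ_δ` is continuous (Fourier transform of an integrable function). [cite: Gallagher1970, Lemma 1 (proof step)] -/
theorem continuous_fourier_triC {δ : ℝ} (hδ : 0 < δ) : Continuous (𝓕 (triC δ)) :=
  VectorFourier.fourierIntegral_continuous Real.continuous_fourierChar continuous_inner
    (integrable_triC hδ)

/-- `K_δ` is integrable (as the complex-valued function `𝓕 Δ_δ`). [cite: Gallagher1970, Lemma 1 (proof step)] -/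
theorem integrable_fourier_triC {δ : ℝ} (hδ : 0 < δ) : Integrable (𝓕 (triC δ)) := by
  refine Integrable.mono' ((integrable_inv_one_add_sq.const_mul (2 * (δ ^ 2 + 1 / π ^ 2))))
    (continuous_fourier_triC hδ).aestronglyMeasurable (Filter.Eventually.of_forall fun t => ?_)
  rw [fourier_triC hδ, Complex.norm_real, Real.norm_eq_abs, abs_of_nonneg (fejerK_nonneg hδ t)]
  exact fejerK_le_majorant hδ t

/-- **Fourier inversion for the pair (Δ_δ, K_δ)**: `∫ K_δ(t) e(ut) dt = Δ_δ(u)`. [cite: Gallagher1970, Lemma 1 (proof step)] -/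
theorem integral_fejerK_mul_cexp {δ : ℝ} (hδ : 0 < δ) (u : ℝ) :
    ∫ t : ℝ, (fejerK δ t : ℂ) * cexp (↑(2 * π * t * u) * I) = (tri δ u : ℂ) := by
  have hinv := (continuous_triC δ).fourierInv_fourier_eq (integrable_triC hδ)
    (integrable_fourier_triC hδ)
  have hu := congrFun hinv u
  rw [Real.fourierInv_eq_fourier_neg, Real.fourier_real_eq_integral_exp_smul] at hu
  simp only [smul_eq_mul, fourier_triC hδ] at hu
  rw [show (tri δ u : ℂ) = triC δ u from rfl, ← hu]
  congr 1
  funext t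
  rw [mul_comm]
  congr 2
  push_cast
  ring

/-! ### Jordan's inequality: `K_δ ≥ 4δ²/π²` on `|t| ≤ T` when `δ T ≤ 1/2` -/

/-- On `|t| ≤ T` with `δT ≤ 1/2`: `K_δ(t) ≥ 4δ²/π²` (from `sin x ≥ (2/π) x` on `[0, π/2]`). [cite: Gallagher1970, Lemma 1 (proof step)] -/
theorem fejerK_ge {δ T t : ℝ} (hδ : 0 < δ) (hδT : δ * T ≤ 1 / 2) (ht : |t| ≤ T) :
    4 * δ ^ 2 / π ^ 2 ≤ fejerK δ t := by
  have hπ : 0 < π := Real.pi_pos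
  rcases eq_or_ne t 0 with rfl | ht0
  · rw [fejerK_zero]
    rw [div_le_iff₀ (by positivity)]
    have h4 : (4 : ℝ) ≤ π ^ 2 := by nlinarith [Real.pi_gt_three, Real.pi_pos]
    nlinarith [h4, sq_nonneg δ]
  rw [fejerK_of_ne_zero hδ.ne' ht0]
  -- reduce to |t|: sin² (πδt) = sin² (πδ|t|), (πt)² = (π|t|)²
  have key : ∀ s : ℝ, 0 < s → s ≤ T → 4 * δ ^ 2 / π ^ 2 ≤ Real.sin (π * δ * s) ^ 2 / (π * s) ^ 2 := by
    intro s hs hsT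
    have hx0 : 0 ≤ π * δ * s := by positivity
    have hx1 : π * δ * s ≤ π / 2 := by
      have : δ * s ≤ 1 / 2 := le_trans (mul_le_mul_of_nonneg_left hsT hδ.le) hδT
      nlinarith
    have hj : 2 / π * (π * δ * s) ≤ Real.sin (π * δ * s) := Real.mul_le_sin hx0 hx1
    have hj' : 2 * δ * s ≤ Real.sin (π * δ * s) := by
      have : 2 / π * (π * δ * s) = 2 * δ * s := by field_simp
      linarith [this]
    rw [le_div_iff₀ (by positivity)]
    have h0 : 0 ≤ 2 * δ * s := by positivity
    calc 4 * δ ^ 2 / π ^ 2 * (π * s) ^ 2 = (2 * δ * s) ^ 2 := by field_simp; ring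
      _ ≤ Real.sin (π * δ * s) ^ 2 := pow_le_pow_left₀ h0 hj' 2
  rcases lt_or_gt_of_ne ht0 with hneg | hpos
  · have := key (-t) (by linarith) (by rw [abs_of_neg hneg] at ht; exact ht)
    rw [show π * δ * -t = -(π * δ * t) by ring, Real.sin_neg, neg_sq,
      show π * -t = -(π * t) by ring, neg_sq] at this
    exact this
  · exact key t hpos (by rw [abs_of_pos hpos] at ht; exact ht)

end Gallagher

end Literature.NumberTheory.LFunctions
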